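import Summits.BirchSwinnertonDyer.BirchSwinnertonDyer.Theorems.EisensteinPrimesTwoVariableKatzBranchRigidity
import Summits.BirchSwinnertonDyer.BirchSwinnertonDyer.Theorems.EisensteinPrimesTwoVariableKatzBranchSupply
import Summits.BirchSwinnertonDyer.BirchSwinnertonDyer.Theorems.EisensteinPrimesTwoVariableNotNormTwist
import Summits.BirchSwinnertonDyer.Rank1Residual.X11b.LambdaSupplyPrime
import Summits.BirchSwinnertonDyer.BirchSwinnertonDyer.Theorems.CongruentShaFreeCutLambdaSupplyAnyPrime
import HarnessLib

/-!
# Rigidity of the reflected de Shalit branch `θ_K‖·‖` on an anticyclotomic line, UNCONDITIONAL: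
# a UNITARY anticyclotomic supply and the admissible sequence it yields
# (step (f) of the [BRω] road R-ψ, assembled; helper file 36 for crux 2 `GoodLatticeBDPValue`,
# stmt-BirchSwinnertonDyer-19032, cell `bsd-eis` seat `bsd-eis-k5-c2`)

Assembles p490348 (`isKatzBranch_ext_of_supply`), p491242 (`katzBranch_admissible_reflect_inv`,
`hasEntireContinuation_heckeLFunction_mul_normCharacter`) and p491537
(`not_isNormTwist_mul_inv_of_isFiniteOrder`) with a UNITARY anticyclotomic character supply:

* (`isUnitary_pow` is reused from `Theorems.CongruentShaFreeCutLambdaSupplyAnyPrime`.)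
* `exists_unitary_interpolationCharacter` — the tree's `X11b.exists_interpolationCharacter`
  (interpolation character `φ = λ^M` of type `(m, −m)`, unramified everywhere, rank-one avatar `e∘ψ`
  through `κ`, `ψ(γ)` a principal unit, `ψ(γ)^{p^k} ≠ 1`) WITH `φ.IsUnitary` exported (`λ` is unitary:
  `X11b.lambdaSupplyAt`; proof = the tree's, verbatim, threading unitarity through the power);
* `exists_admissible_supply_reflect_inv` — for `θ_K` finite-order, `c`-invariant, unramified off
  `S`, over an imaginary quadratic `K` at an odd `p`, `κ` anticyclotomic with topological generator
  `γ`: admissible sequences `(ρ_k, r_k, m_k, j_k)` for the frame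
  `DeShalit1987.IsKatzBranch ι v v̄ S κ γ₀ (reflect θ_K⁻¹) Ω δ Ω_p` (any `v̄, Ω, δ, Ω_p`; `γ₀ ∈ {γ, γ⁻¹}`)
  with `r_k(γ) → 1`, `r_k(γ) ≠ 1` — `ρ_k = φ^{−p^k}`;
* `isKatzBranch_reflect_inv_ext`, `isKatzBranch_reflect_inv_ext_inv` — **two witnesses of the
  reflected branch's one-variable frame at `γ` (resp. `γ⁻¹`) and FIXED periods are EQUAL**.

This is exactly the rigidity the [BRω] wrapper needs (HOME/k5-c2-MEMO-6.md §4 (J3); HOME/k5-ty-g8/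
BR-OMEGA-ROAD.md §2 (f), run on the POINTED branch `ψ_K‖·‖`): the η-translate of the `ω̃_K⁻¹`-branch
slice and the reflected `𝟙̃_K⁻¹`-branch slice are two such witnesses. Pure bookkeeping + Tate + the
tree's supply; no fact, no definition; nothing about BSD.
References: de Shalit 1987 II.4.16–4.17, II.6.1; Castella 2018 Thm. 3.1 (the supply); Tate 1950.
-/

-- the summit namespace `Summit.BirchSwinnertonDyer.BirchSwinnertonDyer` repeats the problem name by design (D-0017)
set_option linter.dupNamespace false
set_option autoImplicit false

noncomputable section

open scoped Classical Topology

open Filter NumberField IsDedekindDomain Field Literature.NumberTheory.EllipticCurves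
  Literature.NumberTheory.GaloisRepresentations Literature.NumberTheory.GaloisRepresentations.HeckeCharacter
  Summit.BirchSwinnertonDyer.Rank1Residual.X11b Summit.BirchSwinnertonDyer.Rank1Residual.X11b.Three.LambdaSupply
  Summit.BirchSwinnertonDyer.Rank1Residual.X11b.LambdaSupply Summit.BirchSwinnertonDyer.Rank1Residual.X11b.Halves

namespace Summit.BirchSwinnertonDyer.BirchSwinnertonDyer.Theorems.IwasawaTwoVariable

section UnitarySupply

variable {K : Type} [Field K] [NumberField K] {p : ℕ} [Fact p.Prime]

/-- **The interpolation character, UNITARY** — `X11b.exists_interpolationCharacter` with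
`φ.IsUnitary` exported: `φ = λ^M` for the unitary `λ` of `X11b.lambdaSupplyAt` and the exponent `M`
of `exists_pow_forall_isUnramifiedAt`; the rest of the statement and proof are the tree's verbatim
(`x₀ = ψ(γ)` principal unit; `x₀^{p^k} ≠ 1` since otherwise `λ^{Mp^k} = 1` would have type
`(Mp^k, −Mp^k) ≠ 0`). [cite: Castella2018, Thm. 3.1 (arXiv:1704.06608 p. 9)] [cite: Weil1956, §1–§2] -/
theorem exists_unitary_interpolationCharacter (hp2 : p ≠ 2) (ι : PadicAlgCl p ≃+* ℂ)
    (κ : ZpExtension K p) (hK : IsImaginaryQuadratic K) (hκ : κ.IsAnticyclotomic)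
    (γ : absoluteGaloisGroup K) (hγ : κ.IsTopGenerator γ) :
    ∃ (φ : HeckeCharacter K) (m : ℕ) (ψ : absoluteGaloisGroup K →ₜ* (PadicAlgCl p)ˣ), 0 < m ∧
      φ.IsUnitary ∧
      (∀ v : HeightOneSpectrum (𝓞 K), φ.IsUnramifiedAt v) ∧
      φ.HasInfinityType (fun _ ↦ (m : ℤ)) (fun _ ↦ -(m : ℤ)) ∧
      IsPAdicAvatarOf ι φ ((FramedRep.unitsContinuousMulEquivOfUnique (Fin 1) (PadicAlgCl p) :
        (PadicAlgCl p)ˣ →ₜ* GL (Fin 1) (PadicAlgCl p)).comp ψ) ∧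
      FactorsThroughZp κ ((FramedRep.unitsContinuousMulEquivOfUnique (Fin 1) (PadicAlgCl p) :
        (PadicAlgCl p)ˣ →ₜ* GL (Fin 1) (PadicAlgCl p)).comp ψ) ∧
      ‖avatarValueAt ((FramedRep.unitsContinuousMulEquivOfUnique (Fin 1) (PadicAlgCl p) :
        (PadicAlgCl p)ˣ →ₜ* GL (Fin 1) (PadicAlgCl p)).comp ψ) γ - 1‖ < 1 ∧
      ∀ k : ℕ, avatarValueAt ((FramedRep.unitsContinuousMulEquivOfUnique (Fin 1) (PadicAlgCl p) :
        (PadicAlgCl p)ˣ →ₜ* GL (Fin 1) (PadicAlgCl p)).comp ψ) γ ^ p ^ k ≠ 1 := by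
  have hp : p.Prime := Fact.out
  haveI : IsTotallyComplex K := hK.2
  obtain ⟨lam, rlam, hunit, hinf, -, hunr, hav, hfac⟩ := lambdaSupplyAt hp2 ι K κ hK hκ
  -- rank-one currency `rlam = e ∘ ψ₀`
  set ψ₀ : absoluteGaloisGroup K →ₜ* (PadicAlgCl p)ˣ :=
    ((FramedRep.unitsContinuousMulEquivOfUnique (Fin 1) (PadicAlgCl p)).symm :
      GL (Fin 1) (PadicAlgCl p) →ₜ* (PadicAlgCl p)ˣ).comp rlam with hψ₀
  have hr : (FramedRep.unitsContinuousMulEquivOfUnique (Fin 1) (PadicAlgCl p) :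
      (PadicAlgCl p)ˣ →ₜ* GL (Fin 1) (PadicAlgCl p)).comp ψ₀ = rlam := comp_symm_comp_eq rlam
  rw [← hr] at hav hfac
  -- the exponent killing the ramification above `p`
  obtain ⟨M, hM, hunrM⟩ := exists_pow_forall_isUnramifiedAt lam
  have hfac' : ∀ n : ℕ, FactorsThroughZp κ
      ((FramedRep.unitsContinuousMulEquivOfUnique (Fin 1) (PadicAlgCl p) :
        (PadicAlgCl p)ˣ →ₜ* GL (Fin 1) (PadicAlgCl p)).comp (ψ₀ ^ n)) :=
    fun n => factorsThroughZp_unitsChar_pow κ hfac n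
  have hav' : ∀ n : ℕ, IsPAdicAvatarOf ι (lam ^ n)
      ((FramedRep.unitsContinuousMulEquivOfUnique (Fin 1) (PadicAlgCl p) :
        (PadicAlgCl p)ˣ →ₜ* GL (Fin 1) (PadicAlgCl p)).comp (ψ₀ ^ n)) :=
    fun n => isPAdicAvatarOf_pow ι hav hunr n
  have htyp : ∀ n : ℕ, (lam ^ n).HasInfinityType (fun _ ↦ (n : ℤ)) (fun _ ↦ -(n : ℤ)) := fun n => by
    have h := HasInfinityType.pow_nat hinf n
    simpa using h
  refine ⟨lam ^ M, M, ψ₀ ^ M, hM, CongruentShaFreeCutLambdaSupplyAnyPrime.isUnitary_pow hunit M,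
    hunrM, htyp M, hav' M, hfac' M, norm_avatarValueAt_sub_one_lt hγ (hfac' M), fun k hk => ?_⟩
  -- non-torsion: suppose `x₀^{p^k} = 1`
  have hval : avatarValueAt ((FramedRep.unitsContinuousMulEquivOfUnique (Fin 1) (PadicAlgCl p) :
      (PadicAlgCl p)ˣ →ₜ* GL (Fin 1) (PadicAlgCl p)).comp (ψ₀ ^ (M * p ^ k))) γ = 1 := by
    rw [pow_mul, avatarValueAt_unitsChar_pow, hk]
  -- the character of `Γ⁻ ≅ ℤ_p` attached to `e ∘ ψ₀^{M p^k}` is trivial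
  obtain ⟨χ, hχc, hχ⟩ := exists_addChar_of_factorsThroughZp (hfac' (M * p ^ k))
  have hχ1 : χ 1 = 1 := by
    have h := hχ γ
    rw [show κ γ = Multiplicative.ofAdd 1 from hγ, toAdd_ofAdd] at h
    rw [h, hval]
  have hψ1 : ψ₀ ^ (M * p ^ k) = 1 := by
    ext σ
    have h1 := hχ σ
    rw [addChar_eq_one_of_map_one hχc hχ1, avatarValueAt_unitsChar, PadicComplex.coe_eq,
      ← map_one (algebraMap (PadicAlgCl p) ℂ_[p])] at h1
    have h2 := (algebraMap (PadicAlgCl p) ℂ_[p]).injective h1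
    rw [← h2]
    simp
  -- so `λ^{M p^k}` and `1` share the avatar `e ∘ 1`
  have hav1 : IsPAdicAvatarOf ι (lam ^ (M * p ^ k))
      ((FramedRep.unitsContinuousMulEquivOfUnique (Fin 1) (PadicAlgCl p) :
        (PadicAlgCl p)ˣ →ₜ* GL (Fin 1) (PadicAlgCl p)).comp 1) := by
    rw [← hψ1]; exact hav' _
  have heq : lam ^ (M * p ^ k) = 1 :=
    eq_of_isPAdicAvatarOf_of_isPAdicAvatarOf ι hav1 (isPAdicAvatarOf_one ι)
      (fun v hv => isUnramifiedAt_pow' (hunr v hv) _) (fun v _ => isUnramifiedAt_one' v)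
  have htyp1 := htyp (M * p ^ k)
  rw [heq] at htyp1
  have hne : ((M * p ^ k : ℕ) : ℤ) ≠ 0 := by exact_mod_cast (Nat.mul_pos hM (pow_pos hp.pos k)).ne'
  exact not_hasInfinityType_one_of_ne_zero hne htyp1

end UnitarySupply

section ReflectRigidity

variable {K : Type} [Field K] [NumberField K] [IsCMField K] {p : ℕ} [Fact p.Prime]

/-- **Admissible sequences on the reflected line `θ_K‖·‖` from the unitary anticyclotomic supply.**
For `θ_K` finite-order, `c`-invariant, unramified at every `w ∉ S`; `K` imaginary quadratic, `p` odd,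
`κ` anticyclotomic with topological generator `γ`: there are sequences `ρ_k` (`= φ^{−p^k}`), rank-one
avatars `r_k` through `κ`, and `n_k ≥ 1` such that each `(ρ_k, r_k, n_k + 1, n_k − 1)` is admissible
for `IsKatzBranch ι v v̄ S κ · (reflect θ_K⁻¹) Ω δ Ω_p` — avatar, factorisation, range, infinity type
`(−(n_k+1), n_k−1)`, unramified off `S`, entire `L(θ_K‖·‖ρ_k, s)` — with `r_k(γ) → 1` and
`r_k(γ) ≠ 1` for every `k`. [cite: deShalit1987, II.4.16 (49)–(50) (store chunk 76–77)]
[cite: Castella2018, Thm. 3.1 (the supply)] [cite: TateThesis1967, Thm. 4.4.1] -/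
theorem exists_admissible_supply_reflect_inv (hp2 : p ≠ 2) (ι : PadicAlgCl p ≃+* ℂ)
    (hK : IsImaginaryQuadratic K) {κ : ZpExtension K p} (hκ : κ.IsAnticyclotomic)
    {γ : absoluteGaloisGroup K} (hγ : κ.IsTopGenerator γ)
    {θK : HeckeCharacter K} (hfin : θK.IsFiniteOrder)
    (hgal : HeckeCharacter.galConj (IsCMField.complexConj K) θK = θK)
    {S : Finset (HeightOneSpectrum (𝓞 K))}
    (hunrθ : ∀ w : HeightOneSpectrum (𝓞 K), w ∉ S → θK.IsUnramifiedAt w) :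
    ∃ (ρ : ℕ → HeckeCharacter K) (r : ℕ → FramedGaloisRep K (PadicAlgCl p) 1) (n : ℕ → ℕ),
      (∀ k, IsPAdicAvatarOf ι (ρ k) (r k)) ∧ (∀ k, FactorsThroughZp κ (r k)) ∧
      (∀ k, n k - 1 < n k + 1) ∧
      (∀ k, (DeShalit1987.reflect θK⁻¹ * ρ k).HasInfinityType
        (fun _ ↦ -((n k + 1 : ℕ) : ℤ)) (fun _ ↦ ((n k - 1 : ℕ) : ℤ))) ∧
      (∀ k (w : HeightOneSpectrum (𝓞 K)), w ∉ S →
        (DeShalit1987.reflect θK⁻¹ * ρ k).IsUnramifiedAt w) ∧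
      (∀ k, LFunction.HasEntireContinuation (heckeLFunction (DeShalit1987.reflect θK⁻¹ * ρ k))) ∧
      Tendsto (fun k ↦ avatarValueAt (r k) γ) atTop (𝓝 1) ∧
      ∀ k, avatarValueAt (r k) γ ≠ 1 := by
  have hp : p.Prime := Fact.out
  haveI : IsTotallyComplex K := hK.2
  obtain ⟨φ₀, m, ψ, hm, hunit, hunr, hinf, hav, hfac, hx1, hne⟩ :=
    exists_unitary_interpolationCharacter hp2 ι κ hK hκ γ hγ
  set e := (FramedRep.unitsContinuousMulEquivOfUnique (Fin 1) (PadicAlgCl p) :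
    (PadicAlgCl p)ˣ →ₜ* GL (Fin 1) (PadicAlgCl p)) with he
  set x₀ : ℂ_[p] := avatarValueAt (e.comp ψ) γ with hx₀
  have hunr' : ∀ v : HeightOneSpectrum (𝓞 K), ((p : ℕ) : 𝓞 K) ∉ v.asIdeal → φ₀.IsUnramifiedAt v :=
    fun v _ => hunr v
  -- the powers `φ₀^{p^k}`, `ψ^{p^k}`
  have hpow_unr : ∀ (n : ℕ) (v : HeightOneSpectrum (𝓞 K)), (φ₀ ^ n).IsUnramifiedAt v :=
    fun n v => isUnramifiedAt_pow' (hunr v) n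
  have hpow_inf : ∀ n : ℕ, (φ₀ ^ n).HasInfinityType (fun _ ↦ ((m * n : ℕ) : ℤ))
      (fun _ ↦ -((m * n : ℕ) : ℤ)) := fun n => by
    have h := HasInfinityType.pow_nat hinf n
    convert h using 2 <;> push_cast <;> ring_nf
  have hpow_av : ∀ n : ℕ, IsPAdicAvatarOf ι (φ₀ ^ n) (e.comp (ψ ^ n)) :=
    fun n => isPAdicAvatarOf_pow ι hav hunr' n
  have hpow_fac : ∀ n : ℕ, FactorsThroughZp κ (e.comp (ψ ^ n)) :=
    fun n => factorsThroughZp_unitsChar_pow κ hfac n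
  have hpow_val : ∀ n : ℕ, avatarValueAt (e.comp (ψ ^ n)) γ = x₀ ^ n :=
    fun n => avatarValueAt_unitsChar_pow ψ γ n
  have hmn : ∀ k : ℕ, 1 ≤ m * p ^ k := fun k ↦ Nat.mul_pos hm (pow_pos hp.pos k)
  -- admissibility of `(φ₀^{p^k})⁻¹` on the reflected line
  have hadm : ∀ k : ℕ, _ := fun k ↦
    katzBranch_admissible_reflect_inv ι hfin hgal hunrθ (κ := κ) (n := m * p ^ k) (hmn k)
      (hpow_unr (p ^ k)) (CongruentShaFreeCutLambdaSupplyAnyPrime.isUnitary_pow hunit (p ^ k))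
      (hpow_inf (p ^ k)) (hpow_av (p ^ k))
      (hpow_fac (p ^ k))
      (not_isNormTwist_mul_inv_of_isFiniteOrder hfin
        (by exact_mod_cast (Nat.pos_iff_ne_zero.mp (hmn k)) : ((m * p ^ k : ℕ) : ℤ) ≠ 0)
        (hpow_inf (p ^ k)))
  refine ⟨fun k ↦ (φ₀ ^ p ^ k)⁻¹, fun k ↦ e.comp (ψ ^ p ^ k)⁻¹, fun k ↦ m * p ^ k,
    fun k ↦ (hadm k).1, fun k ↦ (hadm k).2.1, fun k ↦ (hadm k).2.2.1, fun k ↦ (hadm k).2.2.2.1,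
    fun k ↦ (hadm k).2.2.2.2.1, fun k ↦ (hadm k).2.2.2.2.2, ?_, fun k ↦ ?_⟩
  · -- `x₀^{-p^k} → 1`
    have hlim : Tendsto (fun k : ℕ ↦ x₀ ^ p ^ k) atTop (𝓝 1) := tendsto_pow_prime_pow_padicComplex hx1
    have h := (continuousAt_inv₀ (one_ne_zero (α := ℂ_[p]))).tendsto.comp hlim
    rw [inv_one] at h
    refine h.congr fun k ↦ ?_
    show (x₀ ^ p ^ k)⁻¹ = avatarValueAt (e.comp (ψ ^ p ^ k)⁻¹) γ
    rw [avatarValueAt_unitsChar_inv, hpow_val]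
  · rw [avatarValueAt_unitsChar_inv, hpow_val]
    exact fun h ↦ hne k (inv_eq_one.mp h)

variable {ι : PadicAlgCl p ≃+* ℂ} {v vbar : HeightOneSpectrum (𝓞 K)} {S : Finset (HeightOneSpectrum (𝓞 K))}
  {κ : ZpExtension K p} {γ : absoluteGaloisGroup K} {θK : HeckeCharacter K} {Ω δ : ℂ} {Ωp : ℂ_[p]}

/-- **Rigidity of the reflected branch on an anticyclotomic line, at the generator `γ`.** For `K`
imaginary quadratic, `p` odd, `κ` anticyclotomic with topological generator `γ`, `θ_K` finite-order,
`c`-invariant and unramified off `S`: two witnesses of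
`DeShalit1987.IsKatzBranch ι v v̄ S κ γ (reflect θ_K⁻¹) Ω δ Ω_p` are EQUAL (same periods). Assembles
`isKatzBranch_ext_of_supply` with `exists_admissible_supply_reflect_inv`.
[cite: deShalit1987, II.4.16 (49)–(50), II.4.17 (52)] [cite: Cassels1986, Ch. 4 Thm. 4.1 (Strassmann)] -/
theorem isKatzBranch_reflect_inv_ext (hp2 : p ≠ 2) (hK : IsImaginaryQuadratic K)
    (hκ : κ.IsAnticyclotomic) (hγ : κ.IsTopGenerator γ) (hfin : θK.IsFiniteOrder)
    (hgal : HeckeCharacter.galConj (IsCMField.complexConj K) θK = θK)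
    (hunrθ : ∀ w : HeightOneSpectrum (𝓞 K), w ∉ S → θK.IsUnramifiedAt w)
    {G G' : PowerSeries 𝓞_ℂ_[p]}
    (hG : DeShalit1987.IsKatzBranch ι v vbar S κ γ (DeShalit1987.reflect θK⁻¹) Ω δ Ωp G)
    (hG' : DeShalit1987.IsKatzBranch ι v vbar S κ γ (DeShalit1987.reflect θK⁻¹) Ω δ Ωp G') :
    G = G' := by
  obtain ⟨ρ, r, n, hr, hfac, hjm, hinf, hunr, hL, hlim, hne⟩ :=
    exists_admissible_supply_reflect_inv hp2 ι hK hκ hγ hfin hgal hunrθ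
  exact isKatzBranch_ext_of_supply hG hG' hr hfac hjm hinf (fun k w hw _ ↦ hunr k w hw) hL hlim
    (Frequently.of_forall hne)

/-- **Rigidity of the reflected branch on an anticyclotomic line, at the INVERSE generator `γ⁻¹`**
(the generator at which the two-variable road reads its frames, `muLambda_of_rubin_at_periods`).
[cite: deShalit1987, II.4.16 (49)–(50), II.4.17 (52)] [cite: Cassels1986, Ch. 4 Thm. 4.1 (Strassmann)] -/
theorem isKatzBranch_reflect_inv_ext_inv (hp2 : p ≠ 2) (hK : IsImaginaryQuadratic K)
    (hκ : κ.IsAnticyclotomic) (hγ : κ.IsTopGenerator γ) (hfin : θK.IsFiniteOrder)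
    (hgal : HeckeCharacter.galConj (IsCMField.complexConj K) θK = θK)
    (hunrθ : ∀ w : HeightOneSpectrum (𝓞 K), w ∉ S → θK.IsUnramifiedAt w)
    {G G' : PowerSeries 𝓞_ℂ_[p]}
    (hG : DeShalit1987.IsKatzBranch ι v vbar S κ γ⁻¹ (DeShalit1987.reflect θK⁻¹) Ω δ Ωp G)
    (hG' : DeShalit1987.IsKatzBranch ι v vbar S κ γ⁻¹ (DeShalit1987.reflect θK⁻¹) Ω δ Ωp G') :
    G = G' := by
  obtain ⟨ρ, r, n, hr, hfac, hjm, hinf, hunr, hL, hlim, hne⟩ :=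
    exists_admissible_supply_reflect_inv hp2 ι hK hκ hγ hfin hgal hunrθ
  obtain ⟨hlim', hne'⟩ := tendsto_avatarValueAt_inv_of_tendsto hlim (Frequently.of_forall hne)
  exact isKatzBranch_ext_of_supply hG hG' hr hfac hjm hinf (fun k w hw _ ↦ hunr k w hw) hL hlim' hne'

end ReflectRigidity

end Summit.BirchSwinnertonDyer.BirchSwinnertonDyer.Theorems.IwasawaTwoVariable

end
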